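import Summits.NavierStokesRegularity.NavierStokesRegularity.Theorems.AdaptedFrequencyAdaptedFrequencyConvergesStubBlockSolverApprox
import Summits.NavierStokesRegularity.NavierStokesRegularity.Theorems.AdaptedFrequencyAdaptedFrequencyConvergesStubBlockSolverLimitTools
import Summits.NavierStokesRegularity.NavierStokesRegularity.Theorems.AdaptedFrequencyAdaptedKernelExistsKernelLimitExtract
import Summits.NavierStokesRegularity.NavierStokesRegularity.Theorems.AdaptedFrequencyAdaptedKernelExistsKernelLimitVeryWeakLimit
import Summits.NavierStokesRegularity.NavierStokesRegularity.Theorems.AdaptedFrequencyAdaptedKernelExistsTypeICutoff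
import Literature.Analysis.UnboundedOperators.HeatKernelGradient

/-!
# Crux `AdaptedFrequencyConverges` (stmt-NavierStokesRegularity-10493), line
  `cloud-frame-effective-tsai`: the block solver by PASSAGE TO THE LIMIT (STUB `stub_blockSolver`)

Helper file (lands `--supports stmt-NavierStokesRegularity-10493`).  For `ν > 0`, a drift `b`
jointly smooth on `Ico tb T × ℝ³`, divergence free and bounded by `B`, times `tb < tₘ < T`, and
smooth compactly supported data `f ≥ 0`, there is `W` jointly smooth on the open slab
`Ioo tₘ T × ℝ³` solving `∂ₜW + b·∇W + νΔW = 0` classically, with `0 ≤ W ≤ A e^{−‖x‖²/a}` and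
`|W(t, x) − e^{ν(T−t)Δ}f(x)| ≤ M (T − t)` (`blockSolver_limit`).

Proof (pattern of `kernelLimit_of_hypoelliptic`, crux `AdaptedKernelExists`): cut the drift off
smoothly beyond `Tₙ ↑ T` (`kernel_typeI_cutoff`; a bounded drift obeys the Type-I rate with
constant `B√(T − tb)`), solve with `blockSolver_approx` — whose constants do not see the cut-off;
the solutions `Wₙ` are uniformly bounded, equicontinuous in time through pairings
(`limit_pairing_lipschitz`) and in space (`limit_space_modulus`); extract a pointwise convergent
subsequence (`kernelLimit_extract`, after normalising the mass by the common Gaussian envelope);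
the limit is locally integrable and a very weak solution for the drift `b`
(`kernelLimit_veryWeak_limit`: `bₙ = b` on `[tₘ, Tₙ]`); Hörmander's theorem
(`stub_hypoelliptic`) gives a smooth classical representative, to which the pointwise bounds
transfer everywhere by continuity (`kernelLimit_le_of_ae_le`).
-/

noncomputable section

open MeasureTheory Set Filter Topology Metric Function Real
open scoped Laplacian ContDiff
open Literature.Analysis.FluidPDE Literature.Analysis.UnboundedOperators
open Summit.NavierStokesRegularity.NavierStokesRegularity.Theorems.AdaptedKernelExists.NashEntropyLastBlock
open Summit.NavierStokesRegularity.NavierStokesRegularity.Theorems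

namespace Summit.NavierStokesRegularity.NavierStokesRegularity.Theorems.AdaptedFrequencyConverges.CloudFrameEffectiveTsai

/-- **The block solver on an open slab, by passage to the limit.**  See the module docstring. -/
theorem blockSolver_limit (ν B tb tₘ T : ℝ)
    (b : ℝ → EuclideanSpace ℝ (Fin 3) → EuclideanSpace ℝ (Fin 3)) (f : EuclideanSpace ℝ (Fin 3) → ℝ)
    (hν : 0 < ν) (hB : 0 ≤ B) (htb : tb < tₘ) (htₘ : tₘ < T) (hsm : IsSmoothSpaceTimeOn (Ico tb T) b)
    (hdiv : ∀ t ∈ Ico tb T, VectorCalculus.IsDivFree (b t))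
    (hBd : ∀ t ∈ Ico tb T, ∀ x, ‖b t x‖ ≤ B) (hf : ContDiff ℝ 2 f) (hfc : HasCompactSupport f)
    (hf0 : ∀ x, 0 ≤ f x) :
    ∃ W : ℝ → EuclideanSpace ℝ (Fin 3) → ℝ,
      IsSmoothSpaceTimeOn (Ioo tₘ T) W ∧
      (∀ t ∈ Ioo tₘ T, ∀ x,
        deriv (fun s => W s x) t + fderiv ℝ (W t) x (b t x) + ν * (Δ (W t)) x = 0) ∧
      (∀ t ∈ Ioo tₘ T, ∀ x, 0 ≤ W t x) ∧
      (∃ A a : ℝ, 0 < a ∧ ∀ t ∈ Ioo tₘ T, ∀ x, W t x ≤ A * Real.exp (-‖x‖ ^ 2 / a)) ∧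
      (∃ M : ℝ, ∀ t ∈ Ioo tₘ T, ∀ x, |W t x - heatExtension f (ν * (T - t)) x| ≤ M * (T - t)) := by
  obtain ⟨A, a, M, ha, happ⟩ := blockSolver_approx ν B tb tₘ T f hν hB htb htₘ hf hfc hf0
  have htbT : tb < T := htb.trans htₘ
  have hIco : Ioo tₘ T ⊆ Ico tₘ T := Ioo_subset_Ico_self
  have hsubₘ : Ico tₘ T ⊆ Ico tb T := Ico_subset_Ico_left htb.le
  have hbₘ : IsSmoothSpaceTimeOn (Ico tₘ T) b := hsm.mono hsubₘ
  have hdivₘ : ∀ t ∈ Ico tₘ T, VectorCalculus.IsDivFree (b t) := fun t ht => hdiv t (hsubₘ ht)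
  set O : Set (ℝ × EuclideanSpace ℝ (Fin 3)) := Ioo tₘ T ×ˢ univ with hO_def
  have hO : IsOpen O := isOpen_Ioo.prod isOpen_univ
  -- the Type-I form of the drift bound, for the cut-off
  set C : ℝ := B * Real.sqrt (T - tb) with hC_def
  have hC : 0 ≤ C := by rw [hC_def]; positivity
  have hrate : ∀ t ∈ Ico tb T, ∀ x, ‖b t x‖ ≤ C / Real.sqrt (T - t) := by
    intro t ht x
    have h1 : 0 < Real.sqrt (T - t) := Real.sqrt_pos.2 (sub_pos.2 ht.2)
    have h2 : Real.sqrt (T - t) ≤ Real.sqrt (T - tb) := Real.sqrt_le_sqrt (by linarith [ht.1])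
    rw [hC_def, le_div_iff₀ h1]
    calc ‖b t x‖ * Real.sqrt (T - t) ≤ B * Real.sqrt (T - t) :=
          mul_le_mul_of_nonneg_right (hBd t ht x) h1.le
      _ ≤ B * Real.sqrt (T - tb) := mul_le_mul_of_nonneg_left h2 hB
  /- Step 0: the sequence of cut-off drifts and solutions -/
  set Tn : ℕ → ℝ := fun n => T - (T - tₘ) / ((n : ℝ) + 2) with hTn_def
  have hTtₘ : 0 < T - tₘ := sub_pos.2 htₘ
  have hTn₀ : ∀ n, tₘ < Tn n := by
    intro n
    simp only [hTn_def]
    have h2 : (1 : ℝ) < (n : ℝ) + 2 := by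
      have := (Nat.cast_nonneg n : (0:ℝ) ≤ n); linarith
    have : (T - tₘ) / ((n : ℝ) + 2) < T - tₘ := div_lt_self hTtₘ h2
    linarith
  have hTnT : ∀ n, Tn n < T := by
    intro n
    simp only [hTn_def]
    have : 0 < (T - tₘ) / ((n : ℝ) + 2) := by positivity
    linarith
  have hTn_mono : ∀ m n : ℕ, m ≤ n → Tn m ≤ Tn n := by
    intro m n hmn
    simp only [hTn_def]
    have h1 : (T - tₘ) / ((n : ℝ) + 2) ≤ (T - tₘ) / ((m : ℝ) + 2) :=
      div_le_div_of_nonneg_left hTtₘ.le (by positivity) (by exact_mod_cast Nat.add_le_add_right hmn 2)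
    linarith
  have hTn_ev : ∀ t : ℝ, t < T → ∃ N : ℕ, ∀ n, N ≤ n → t ≤ Tn n := by
    intro t ht
    obtain ⟨N, hN⟩ := exists_nat_gt ((T - tₘ) / (T - t))
    refine ⟨N, fun n hn => ?_⟩
    simp only [hTn_def]
    have hTt : 0 < T - t := sub_pos.2 ht
    have h1 : (T - tₘ) / (T - t) ≤ (n : ℝ) + 2 := by
      have : (N : ℝ) ≤ n := by exact_mod_cast hn
      linarith
    have h2 : (T - tₘ) / ((n : ℝ) + 2) ≤ T - t := by
      rw [div_le_iff₀ (by positivity)]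
      rw [div_le_iff₀ hTt] at h1
      linarith [h1]
    linarith
  have hfam : ∀ n : ℕ, ∃ (b' : ℝ → EuclideanSpace ℝ (Fin 3) → EuclideanSpace ℝ (Fin 3))
      (W' : ℝ → EuclideanSpace ℝ (Fin 3) → ℝ),
      (∀ t ∈ Ico tb T, t ≤ Tn n → b' t = b t) ∧
      IsSmoothSpaceTimeOn (Ico tb T) b' ∧
      (∀ t ∈ Ico tb T, VectorCalculus.IsDivFree (b' t)) ∧
      (∀ t x, ‖b' t x‖ ≤ ‖b t x‖) ∧
      IsSmoothSpaceTimeOn (Ioo tₘ T) W' ∧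
      (∀ t ∈ Ioo tₘ T, ∀ x,
        deriv (fun s => W' s x) t + fderiv ℝ (W' t) x (b' t x) + ν * (Δ (W' t)) x = 0) ∧
      (∀ φ : ℝ × EuclideanSpace ℝ (Fin 3) → ℝ, ContDiff ℝ ∞ φ → HasCompactSupport φ →
        tsupport φ ⊆ Ioo tₘ T ×ˢ univ →
        ∫ p : ℝ × (EuclideanSpace ℝ (Fin 3)), W' p.1 p.2 * (deriv (fun s => φ (s, p.2)) p.1 +
          fderiv ℝ (fun y => φ (p.1, y)) p.2 (b' p.1 p.2) -
          ν * (Δ (fun y => φ (p.1, y))) p.2) = 0) ∧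
      (∀ t ∈ Ioo tₘ T, ∀ x, 0 ≤ W' t x) ∧
      (∀ t ∈ Ioo tₘ T, ∀ x, W' t x ≤ A * Real.exp (-‖x‖ ^ 2 / a)) ∧
      (∀ t ∈ Ioo tₘ T, ∀ x, |W' t x - heatExtension f (ν * (T - t)) x| ≤ M * (T - t)) := by
    intro n
    obtain ⟨b', hsm', hdiv', -, hagree, hdom, -, T₁, hT₁, hvan⟩ :=
      kernel_typeI_cutoff hC hsm hdiv hrate (hTnT n)
    obtain ⟨W', h1, h2, h3, h4, h5, h6⟩ := happ b' hsm' hdiv'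
      (fun t ht x => (hdom t x).trans (hBd t ht x)) ⟨T₁, ⟨(hTn₀ n).trans hT₁.1, hT₁.2⟩, hvan⟩
    exact ⟨b', W', hagree, hsm', hdiv', hdom, h1, h2, h3, h4, h5, h6⟩
  choose bs Ws hagree hsm' hdiv' hdom hWs hcl hweak hpos hup hterm using hfam
  /- Step 1: uniform bounds -/
  have hexp1 : ∀ x : EuclideanSpace ℝ (Fin 3), Real.exp (-‖x‖ ^ 2 / a) ≤ 1 := fun x => by
    rw [Real.exp_le_one_iff, neg_div]
    have : 0 ≤ ‖x‖ ^ 2 / a := by positivity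
    linarith
  have hA0 : 0 ≤ A := by
    have hmid : (tₘ + T) / 2 ∈ Ioo tₘ T := ⟨by linarith, by linarith⟩
    have h := (hpos 0 _ hmid 0).trans (hup 0 _ hmid 0)
    exact nonneg_of_mul_nonneg_left h (Real.exp_pos _)
  have hsup : ∀ n, ∀ t ∈ Ioo tₘ T, ∀ x, |Ws n t x| ≤ A := by
    intro n t ht x
    rw [abs_of_nonneg (hpos n t ht x)]
    exact (hup n t ht x).trans (mul_le_of_le_one_right hA0 (hexp1 x))
  /- Step 2: extraction (normalising the mass by the Gaussian envelope) -/
  have hgi : Integrable fun x : EuclideanSpace ℝ (Fin 3) => Real.exp (-‖x‖ ^ 2 / a) := by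
    have h := integrable_gaussian_of_pos (E := EuclideanSpace ℝ (Fin 3)) (b := 1 / a) (by positivity)
    refine h.congr (Eventually.of_forall fun x => ?_)
    ring_nf
  set Ia : ℝ := ∫ x : EuclideanSpace ℝ (Fin 3), Real.exp (-‖x‖ ^ 2 / a) with hIa
  have hIa0 : 0 ≤ Ia := integral_nonneg fun x => (Real.exp_pos _).le
  set Cm : ℝ := A * Ia + 1 with hCm
  have hCm1 : 1 ≤ Cm := by rw [hCm]; nlinarith
  have hCm0 : 0 < Cm := by linarith
  have hCmne : Cm ≠ 0 := hCm0.ne'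
  have hcont : ∀ n, ∀ t ∈ Ioo tₘ T, Continuous (Ws n t) := fun n t ht =>
    (prekernel_contDiff_slice (hWs n) ht).continuous
  have hints : ∀ n, ∀ t ∈ Ioo tₘ T, Integrable (Ws n t) := fun n t ht =>
    (hgi.const_mul A).mono' (hcont n t ht).aestronglyMeasurable
      (Eventually.of_forall fun x => by rw [Real.norm_eq_abs]; exact
        (abs_of_nonneg (hpos n t ht x)).le.trans (hup n t ht x))
  have hmass : ∀ n, ∀ t ∈ Ioo tₘ T, ∫ x, Ws n t x ≤ A * Ia := fun n t ht => by
    rw [hIa, ← integral_const_mul]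
    exact integral_mono (hints n t ht) (hgi.const_mul A) fun x => hup n t ht x
  set Gs : ℕ → ℝ → EuclideanSpace ℝ (Fin 3) → ℝ := fun n t x => Ws n t x / Cm with hGs
  have hequi_t : ∀ ψ : EuclideanSpace ℝ (Fin 3) → ℝ, ContDiff ℝ ∞ ψ → HasCompactSupport ψ →
      ∀ t₁ t₂ : ℝ, tₘ < t₁ → t₂ < T → ∃ L : ℝ, ∀ n, ∀ s ∈ Icc t₁ t₂, ∀ t ∈ Icc t₁ t₂,
        |(∫ x, ψ x * Gs n t x) - ∫ x, ψ x * Gs n s x| ≤ L * |t - s| := by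
    intro ψ hψ hψc t₁ t₂ h₁ h₂
    have hψ2 : ContDiff ℝ 2 ψ := hψ.of_le (by norm_cast)
    set L : ℝ := ∫ x, A * (B * ‖fderiv ℝ ψ x‖ + ν * |(Δ ψ) x|) with hL
    refine ⟨L / Cm, fun n s hs t ht => ?_⟩
    have hsub : Icc t₁ t₂ ⊆ Ioo tₘ T := fun r hr => ⟨h₁.trans_le hr.1, hr.2.trans_lt h₂⟩
    have h1 := limit_pairing_lipschitz (A := B) (Mb := A) hν.le ((hsm' n).mono hsubₘ)
      (fun r hr => hdiv' n r (hsubₘ hr)) (hWs n) (hcl n) hψ2 hψc h₁ h₂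
      (fun r hr x => (hdom n r x).trans (hBd r (hsubₘ (hIco (hsub hr))) x)) hA0
      (fun r hr x => hsup n r (hsub hr) x) hs ht
    have e : ∀ r, ∫ x, ψ x * Gs n r x = (∫ x, ψ x * Ws n r x) / Cm := fun r => by
      simp only [hGs]
      rw [← integral_div]
      exact integral_congr_ae (Eventually.of_forall fun x => by ring)
    rw [e t, e s, ← sub_div, abs_div, abs_of_pos hCm0, div_mul_eq_mul_div]
    exact div_le_div_of_nonneg_right h1 hCm0.le
  have hequi_x : ∀ t ∈ Ioo tₘ T, ∀ x : EuclideanSpace ℝ (Fin 3), ∀ ε : ℝ, 0 < ε → ∃ δ : ℝ, 0 < δ ∧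
      ∀ n (y : EuclideanSpace ℝ (Fin 3)), ‖y - x‖ ≤ δ → |Gs n t y - Gs n t x| ≤ ε := by
    intro t ht x ε hε
    set τ : ℝ := (T - t) / 2 with hτ
    have hτ0 : 0 < τ := by rw [hτ]; linarith [ht.2]
    have htT : t + τ < T := by rw [hτ]; linarith [ht.2]
    set Mw : ℝ := A + 1 with hMw
    have hMw0 : 0 < Mw := by rw [hMw]; linarith
    have hGM : ∀ n, ∀ s ∈ Icc t (t + τ), ∀ z, |Ws n s z| ≤ Mw := fun n s hs z =>
      (hsup n s ⟨ht.1.trans_le hs.1, hs.2.trans_lt htT⟩ z).trans (by rw [hMw]; linarith)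
    set ρ : ℝ := Real.sqrt (ν * τ) with hρ
    have hρ0 : 0 < ρ := Real.sqrt_pos.2 (mul_pos hν hτ0)
    have hρτ : ρ ^ 2 ≤ ν * τ := by rw [hρ, Real.sq_sqrt (mul_pos hν hτ0).le]
    have hAB : 0 ≤ B / ν := div_nonneg hB hν.le
    set δ : ℝ := min (lipRad (B / ν) ρ)
      (ε / (lipConst (B / ν) ρ (Module.finrank ℝ (EuclideanSpace ℝ (Fin 3))) * Mw + 1)) with hδ
    have hLc : 0 < lipConst (B / ν) ρ (Module.finrank ℝ (EuclideanSpace ℝ (Fin 3))) :=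
      lipConst_pos hAB hρ0 (Nat.cast_nonneg _)
    have hδ0 : 0 < δ := lt_min (lipRad_pos hAB hρ0) (by positivity)
    refine ⟨δ, hδ0, fun n y hy => ?_⟩
    have h1 := limit_space_modulus hν ht.1 hτ0 htT ((hsm' n).mono hsubₘ)
      (fun s hs z => (hdom n s z).trans (hBd s (hsubₘ hs) z)) hB (hWs n) (hcl n) hMw0 (hGM n)
      hρ0 hρτ hε x y hy
    simp only [hGs]
    rw [← sub_div, abs_div, abs_of_pos hCm0]
    exact (div_le_self (abs_nonneg _) hCm1).trans h1
  obtain ⟨φs, hφs, Glim, hconv⟩ := kernelLimit_extract (Gs := Gs)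
    (fun n t ht => (hcont n t ht).div_const Cm)
    (fun n t ht x => div_nonneg (hpos n t ht x) hCm0.le)
    (fun n t ht => (hints n t ht).div_const Cm)
    (fun n t ht => by
      simp only [hGs]
      rw [integral_div, div_le_one hCm0]
      exact (hmass n t ht).trans (by rw [hCm]; linarith))
    hequi_t hequi_x
  /- Step 3: the limit and its very weak equation -/
  set Wlim : ℝ → EuclideanSpace ℝ (Fin 3) → ℝ := fun t x => Cm * Glim t x with hWlim
  have hconvW : ∀ t ∈ Ioo tₘ T, ∀ x, Tendsto (fun n => Ws (φs n) t x) atTop (𝓝 (Wlim t x)) := by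
    intro t ht x
    have h := (hconv t ht x).const_mul Cm
    refine h.congr fun n => ?_
    simp only [hGs]
    field_simp
  have hφs_ge : ∀ n, n ≤ φs n := fun n => hφs.id_le n
  have hTn_ev' : ∀ t : ℝ, t < T → ∃ N : ℕ, ∀ n, N ≤ n → t ≤ Tn (φs n) := by
    intro t ht
    obtain ⟨N, hN⟩ := hTn_ev t ht
    exact ⟨N, fun n hn => (hN n hn).trans (hTn_mono n (φs n) (hφs_ge n))⟩
  have hcontO : ∀ n, ContinuousOn (fun p : ℝ × EuclideanSpace ℝ (Fin 3) => Ws (φs n) p.1 p.2) O :=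
    fun n => (hWs (φs n)).continuousOn
  have hboundO : ∀ t₂ : ℝ, t₂ < T → ∃ Mb : ℝ, ∀ n, ∀ t ∈ Ioc tₘ t₂, ∀ x,
      |Ws (φs n) t x| ≤ Mb := fun t₂ ht₂ => ⟨A, fun n t ht x => hsup (φs n) t ⟨ht.1, ht.2.trans_lt ht₂⟩ x⟩
  have hagree' : ∀ n, ∀ t ∈ Icc tₘ (Tn (φs n)), bs (φs n) t = b t := fun n t ht =>
    hagree (φs n) t ⟨htb.le.trans ht.1, ht.2.trans_lt (hTnT _)⟩ ht.2
  have hloc := kernelLimit_locallyIntegrableOn_limit hcontO hboundO hconvW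
  have hweakL := kernelLimit_veryWeak_limit (ν := ν) hbₘ hTn_ev' hagree' hcontO hboundO hconvW
    (fun n => hweak (φs n))
  /- Step 4: hypoelliptic smoothing -/
  obtain ⟨g, hgs, hae, hclg⟩ :=
    stub_hypoelliptic ν tₘ T b (fun p => Wlim p.1 p.2) hν htₘ hbₘ hdivₘ hloc hweakL
  have hgc : ContinuousOn (fun p : ℝ × EuclideanSpace ℝ (Fin 3) => g p.1 p.2) O := hgs.continuousOn
  /- Step 5: transfer of the pointwise bounds -/
  obtain ⟨F, hF⟩ : ∃ F : ℝ → EuclideanSpace ℝ (Fin 3) → ℝ,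
      F = fun t x => heatExtension f (ν * (T - t)) x := ⟨_, rfl⟩
  have hFc : ContinuousOn (fun p : ℝ × EuclideanSpace ℝ (Fin 3) => F p.1 p.2) O :=
    (caloric_isSmoothSpaceTimeOn hν hf.continuous hfc hF).continuousOn.mono
      (prod_mono Ioo_subset_Iio_self Subset.rfl)
  have hlim0 : ∀ t ∈ Ioo tₘ T, ∀ x, 0 ≤ Wlim t x := fun t ht x =>
    ge_of_tendsto (hconvW t ht x) (Eventually.of_forall fun n => hpos (φs n) t ht x)
  have hlimU : ∀ t ∈ Ioo tₘ T, ∀ x, Wlim t x ≤ A * Real.exp (-‖x‖ ^ 2 / a) := fun t ht x =>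
    le_of_tendsto (hconvW t ht x) (Eventually.of_forall fun n => hup (φs n) t ht x)
  have hlimT : ∀ t ∈ Ioo tₘ T, ∀ x, |Wlim t x - F t x| ≤ M * (T - t) := by
    intro t ht x
    have h := ((hconvW t ht x).sub_const (F t x)).abs
    refine le_of_tendsto h (Eventually.of_forall fun n => ?_)
    have := hterm (φs n) t ht x
    rw [hF]
    exact this
  have henvc : ContinuousOn (fun p : ℝ × EuclideanSpace ℝ (Fin 3) =>
      A * Real.exp (-‖p.2‖ ^ 2 / a)) O := by fun_prop
  have hMc : ContinuousOn (fun p : ℝ × EuclideanSpace ℝ (Fin 3) => M * (T - p.1)) O := by fun_prop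
  have hg0 : ∀ t ∈ Ioo tₘ T, ∀ x, 0 ≤ g t x := by
    intro t ht x
    exact kernelLimit_le_of_ae_le (E := EuclideanSpace ℝ (Fin 3)) hO (f := fun _ => (0:ℝ))
      (h := fun p => g p.1 p.2) continuousOn_const hgc (by
        filter_upwards [hae] with p hp hpO
        rw [← hp hpO]; exact hlim0 p.1 hpO.1 p.2) (t, x) ⟨ht, mem_univ x⟩
  have hgU : ∀ t ∈ Ioo tₘ T, ∀ x, g t x ≤ A * Real.exp (-‖x‖ ^ 2 / a) := by
    intro t ht x
    exact kernelLimit_le_of_ae_le (E := EuclideanSpace ℝ (Fin 3)) hO (f := fun p => g p.1 p.2)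
      (h := fun p => A * Real.exp (-‖p.2‖ ^ 2 / a)) hgc henvc (by
        filter_upwards [hae] with p hp hpO
        rw [← hp hpO]; exact hlimU p.1 hpO.1 p.2) (t, x) ⟨ht, mem_univ x⟩
  have hgT : ∀ t ∈ Ioo tₘ T, ∀ x, |g t x - F t x| ≤ M * (T - t) := by
    intro t ht x
    rw [abs_le]
    constructor
    · have h : F t x - M * (T - t) ≤ g t x :=
        kernelLimit_le_of_ae_le (E := EuclideanSpace ℝ (Fin 3)) hO
          (f := fun p => F p.1 p.2 - M * (T - p.1)) (h := fun p => g p.1 p.2) (hFc.sub hMc) hgc (by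
            filter_upwards [hae] with p hp hpO
            rw [← hp hpO]; linarith [(abs_le.1 (hlimT p.1 hpO.1 p.2)).1]) (t, x) ⟨ht, mem_univ x⟩
      linarith
    · have h : g t x ≤ F t x + M * (T - t) :=
        kernelLimit_le_of_ae_le (E := EuclideanSpace ℝ (Fin 3)) hO
          (f := fun p => g p.1 p.2) (h := fun p => F p.1 p.2 + M * (T - p.1)) hgc (hFc.add hMc) (by
            filter_upwards [hae] with p hp hpO
            rw [← hp hpO]; linarith [(abs_le.1 (hlimT p.1 hpO.1 p.2)).2]) (t, x) ⟨ht, mem_univ x⟩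
      linarith
  refine ⟨g, hgs, hclg, hg0, ⟨A, a, ha, hgU⟩, M, fun t ht x => ?_⟩
  have h := hgT t ht x
  rw [hF] at h
  exact h

/-! ### Registered sub-goal -/

/-- **Registered sub-goal `stub_blockSolver_limit`** (closed form of `blockSolver_limit`, sub-goal
of STUB `stub_blockSolver`): the block solver on an open slab for a bounded smooth
divergence-free drift, by passage to the limit in a terminal cut-off of the drift. -/
theorem stub_blockSolver_limit :
    ∀ (ν B tb tₘ T : ℝ) (b : ℝ → (EuclideanSpace ℝ (Fin 3)) → (EuclideanSpace ℝ (Fin 3))) (f : (EuclideanSpace ℝ (Fin 3)) → ℝ), 0 < ν → 0 ≤ B → tb < tₘ → tₘ < T → IsSmoothSpaceTimeOn (Ico tb T) b → (∀ t ∈ Ico tb T, VectorCalculus.IsDivFree (b t)) → (∀ t ∈ Ico tb T, ∀ x, ‖b t x‖ ≤ B) → ContDiff ℝ 2 f → HasCompactSupport f → (∀ x, 0 ≤ f x) → ∃ W : ℝ → (EuclideanSpace ℝ (Fin 3)) → ℝ, IsSmoothSpaceTimeOn (Ioo tₘ T) W ∧ (∀ t ∈ Ioo tₘ T, ∀ x,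 deriv (fun s => W s x) t + fderiv ℝ (W t) x (b t x) + ν * Laplacian.laplacian (W t) x = 0) ∧ (∀ t ∈ Ioo tₘ T, ∀ x, 0 ≤ W t x) ∧ (∃ A a : ℝ, 0 < a ∧ ∀ t ∈ Ioo tₘ T, ∀ x, W t x ≤ A * Real.exp (-‖x‖ ^ 2 / a)) ∧ (∃ M : ℝ, ∀ t ∈ Ioo tₘ T, ∀ x, |W t x - Literature.Analysis.UnboundedOperators.heatExtension f (ν * (T - t)) x| ≤ M * (T - t)) :=
  fun ν B tb tₘ T b f hν hB htb htₘ hsm hdiv hBd hf hfc hf0 =>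
    blockSolver_limit ν B tb tₘ T b f hν hB htb htₘ hsm hdiv hBd hf hfc hf0

end Summit.NavierStokesRegularity.NavierStokesRegularity.Theorems.AdaptedFrequencyConverges.CloudFrameEffectiveTsai

end
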